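import Literature.AlgebraicGeometry.HodgeTheory.WeilClassesCyclicPrymDegreeThree
import Literature.AlgebraicGeometry.HodgeTheory.DegreeOneHodgeTypes
import Literature.AlgebraicGeometry.Motives.JacobianAlbaneseCriterion
import HarnessLib

/-!
# The Jacobian dimension fact read through the Hodge genus `h^{1,0}(C)`

Topic `AlgebraicGeometry/HodgeTheory`; namespace `Literature.AlgebraicGeometry.HodgeTheory`. A
theorem-only file (no definition, no named fact, sorry-free) on the path of the named facts
`Literature.AlgebraicGeometry.HodgeTheory.Schoen1988_cyclicPrym_weilClasses_algebraic_degreeSix` /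
`…_degreeThree` (`WeilClassesCyclicPrym.lean`; C. Schoen, Compositio Math. 65 (1988), Cor. 3.1 with
Thm. 2.0) through their Jacobian input
`Literature.AlgebraicGeometry.Motives.two_mul_dim_eq_finrank_bettiCohomology` (`2 dim J = b₁(C(ℂ))`
for the tree's ABSTRACT Albanese-Jacobians `𝒥 : Jacobian C`; Milne, *Jacobian Varieties*, Prop. 2.1
"The Jacobian has dimension `g = dim Γ(C, Ω¹)`" with Thm. 2.5; Lange 2023, §4.1.1).

Milne's `g` is the HODGE genus `h^{1,0}(C) = dim H^{1,0}(C(ℂ))`, and the printed proof of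
`b₁(C) = 2 dim J` splits into a Hodge-theoretic half (`b₁ = h^{1,0} + h^{0,1} = 2 h^{1,0}`, Hodge
decomposition and symmetry in degree one — Voisin I, Cor. 6.12 and 6.14; Griffiths–Harris p. 116)
and the existence half (`dim J = h^{1,0}(C)`: the Jacobian/Albanese is built on `H⁰(C, Ω¹)^∨`, so
that every holomorphic `1`-form on `C` is the pull-back of an invariant form on `J`; Lange §4.1.1,
Milne Prop. 2.1 / §2 "the tangent space to `J` at `0` is `H¹(C, 𝒪_C)`"). This file PROVES the
Hodge-theoretic half on the tree's real carriers, unconditionally (all inputs are theorems of the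
tree: existence of Hodge models `nonempty_hodgeModel_holds`, the degree-one bookkeeping of
`DegreeOneHodgeTypes`, `AbelianVariety.isSmoothProjective_holds`, `AbelianVariety.finrank_complexBetti_one`,
finite index of `(f^P)_* π₁(C(ℂ))` in `π₁(J(ℂ))` — `Jacobian.index_range_map_abelJacobi_ne_zero`), and
isolates the existence half as the exact residual statement:

* §1 `finrank_hodgeOneZero_eq_finrank_hodgeZeroOne`, `finrank_complexBetti_one_eq_two_mul_finrank_hodgeOneZero`,
  `finrank_bettiCohomology_one_eq_two_mul_finrank_hodgeOneZero` — `h^{1,0} = h^{0,1}` and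
  `b₁(X(ℂ)) = 2 h^{1,0}(X)` for every smooth projective complex `X`;
* §2 `AbelianVariety.finrank_hodgeOneZero_eq_dim` (and `…ZeroOne…`) — `h^{1,0}(A) = dim A`
  (Mumford §1 (4): `H¹(A(ℂ); ℂ) = T^∨ ⊕ T̄^∨`, `dim T = g`);
* §3 `injective_complexBetti_map_abelJacobi_one` — `(f^P)^* : H¹(J(ℂ); ℂ) ↪ H¹(C(ℂ); ℂ)` is
  injective (unconditionally); `map_hodgeOneZero_abelJacobi_le` — it maps `H^{1,0}(J)` into
  `H^{1,0}(C)`; hence `Jacobian.dim_le_finrank_hodgeOneZero` — **`dim J ≤ h^{1,0}(C)`** for every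
  Jacobian of a smooth projective complex curve, the Hodge-theoretic twin of the tree's
  `Jacobian.dim_le_genus` (`dim J ≤ ½ b₁`);
* §4 per curve: `b₁(C(ℂ)) ≤ 2 dim J ⟺ h^{1,0}(C) ≤ dim J ⟺ dim J = h^{1,0}(C) ⟺ H^{1,0}(C) ⊆ range (f^P)^*`
  (`finrank_bettiCohomology_le_two_mul_dim_iff_finrank_hodgeOneZero_le`,
  `hodgeOneZero_le_range_iff_finrank_hodgeOneZero_le`, …); and at the level of the named fact:
  `two_mul_dim_eq_finrank_bettiCohomology ⟺ (∀ C 𝒥, dim J = h^{1,0}(C))` — Milne's Prop. 2.1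
  verbatim, `g` read as `h^{1,0}` — `⟺ (∀ C 𝒥 P, H^{1,0}(C) ⊆ range (f^P)^*)` — "every holomorphic
  `1`-form class on `C(ℂ)` is pulled back from `J`", the analytic Albanese property, which is thereby
  the precise open kernel of the fact (`two_mul_dim_eq_finrank_bettiCohomology_iff_forall_dim_eq_finrank_hodgeOneZero`,
  `…_iff_forall_hodgeOneZero_le_range`, `…_of_forall_finrank_hodgeOneZero_le`);
* §4b the Albanese criterion in Hodge-genus form: `range φ^* ⊆ range (f^P)^*` for every
  `φ : C → A` (universal property, Milne Prop. 6.1), so SOME `φ` to SOME abelian variety with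
  `H^{1,0}(C) ⊆ range φ^*` gives `dim J = h^{1,0}(C)` (`finrank_hodgeOneZero_le_dim_of_hodgeOneZero_le_range`),
  and `two_mul_dim_eq_finrank_bettiCohomology ⟺ (∀ C with a Jacobian, ∃ A φ, H^{1,0}(C) ⊆ range φ^*)`
  (`…_iff_forall_exists_hodgeOneZero_le_range`) — the existence statement of the analytic theory
  with no reference to the abstract `𝒥`;
* §5 the two Schoen facts from the Hodge-genus bound on their own data and one non-zero algebraic
  Weil class (`Schoen1988_cyclicPrym_weilClasses_algebraic_degreeSix_of_finrank_hodgeOneZero_le_of_exists_weilClass`,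
  `…degreeThree…`), through the `…_of_finrank_le_of_exists_weilClass` assemblies of
  `WeilClassesCyclicPrymOneClass` / `WeilClassesCyclicPrymDegreeThree`.

## References

* J. S. Milne, *Jacobian Varieties*, Ch. VII of Cornell–Silverman, *Arithmetic Geometry* (1986):
  §2 Prop. 2.1 ("The Jacobian has dimension `g = dim Γ(C, Ω¹)`", proof: "the tangent space to `J`
  at `0` is `H¹(C, 𝒪_C)`") and Thm. 2.5. [Milne1986JacobianVarieties]
* H. Lange, *Abelian Varieties over the Complex Numbers*, Grundlehren Text Editions (2023), §4.1.1
  (`J(C) = H⁰(ω_C)^*/H₁(C, ℤ)`) and Lemma 4.4.1. [Lange2023AbelianVarietiesC]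
* C. Voisin, *Hodge Theory and Complex Algebraic Geometry I* (CUP 2002), §6.1.3 Cor. 6.12, Cor. 6.14
  (Hodge decomposition and symmetry), §7.3.2 (functoriality). [VoisinHodgeI2002]
* D. Mumford, *Abelian Varieties* (1970), §1 (4) (`H¹(X, ℂ) = T^∨ ⊕ T̄^∨`). [MumfordAV1970]
* C. Schoen, *Hodge classes on self-products of a variety with an automorphism*, Compositio Math.
  65 (1988), Cor. 3.1 with Thm. 2.0. [Schoen1988HodgeWeil]
-/

noncomputable section

open CategoryTheory AlgebraicGeometry
open Literature.AlgebraicTopology.SingularHomology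
open Literature.AlgebraicGeometry.Motives (IsSmoothProjective Jacobian)
open scoped MonObj

namespace Literature.AlgebraicGeometry.HodgeTheory

/-! ### §1 `h^{1,0} = h^{0,1}` and `b₁ = 2 h^{1,0}` for a smooth projective complex variety -/

section HodgeGenus

variable {n : ℕ} {X : Motives.SchemeOver ℂ}

/-- **Hodge symmetry in degree one, `h^{1,0}(X) = h^{0,1}(X)`**: complex conjugation of
coefficients exchanges `H^{1,0}` and `H^{0,1}` (`conjClass_mem_hodgeZeroOne/OneZero`), and two
subspaces exchanged by conjugation have the same dimension. [cite: VoisinHodgeI2002, §6.1.3 Cor. 6.12 and Cor. 6.14] -/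
theorem finrank_hodgeOneZero_eq_finrank_hodgeZeroOne (hX : IsSmoothProjective n X) :
    Module.finrank ℂ (hodgeOneZero hX) = Module.finrank ℂ (hodgeZeroOne hX) := by
  haveI := finite_complexBetti_of_isSmoothProjective hX 1
  exact finrank_eq_of_conjClass_mapsTo (hodgeOneZero hX) (hodgeZeroOne hX)
    (fun _ hx ↦ conjClass_mem_hodgeZeroOne hX hx) (fun _ hx ↦ conjClass_mem_hodgeOneZero hX hx)

/-- **`b₁(X(ℂ)) = 2 h^{1,0}(X)`** (complex coefficients): `H¹ = H^{1,0} ⊕ H^{0,1}`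
(`isCompl_hodgeOneZero_hodgeZeroOne`) and `h^{1,0} = h^{0,1}`.
[cite: VoisinHodgeI2002, §6.1.3 Cor. 6.12 and Cor. 6.14] -/
theorem finrank_complexBetti_one_eq_two_mul_finrank_hodgeOneZero (hX : IsSmoothProjective n X) :
    Module.finrank ℂ (complexBetti X 1) = 2 * Module.finrank ℂ (hodgeOneZero hX) := by
  haveI := finite_complexBetti_of_isSmoothProjective hX 1
  have h := Submodule.finrank_add_eq_of_isCompl (isCompl_hodgeOneZero_hodgeZeroOne hX)
  rw [← finrank_hodgeOneZero_eq_finrank_hodgeZeroOne hX] at h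
  omega

/-- **`b₁(X(ℂ)) = 2 h^{1,0}(X)`**, rational coefficients on the left (`dim_ℚ H¹(X(ℂ); ℚ) =
dim_ℂ H¹(X(ℂ); ℂ)`, universal coefficients). [cite: VoisinHodgeI2002, §6.1.3 Cor. 6.12 and Cor. 6.14] -/
theorem finrank_bettiCohomology_one_eq_two_mul_finrank_hodgeOneZero (hX : IsSmoothProjective n X) :
    Module.finrank ℚ (Motives.bettiCohomology X 1) = 2 * Module.finrank ℂ (hodgeOneZero hX) := by
  rw [← finrank_complexBetti_eq_finrank_bettiCohomology]
  exact finrank_complexBetti_one_eq_two_mul_finrank_hodgeOneZero hX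

/-- `h^{1,0}(X) = ½ b₁(X(ℂ))`: the Hodge genus is the topological genus
`Literature.NumberTheory.DiophantineGeometry.genus X = dim_ℚ H¹(X(ℂ); ℚ) / 2`.
[cite: VoisinHodgeI2002, §6.1.3 Cor. 6.12 and Cor. 6.14] -/
theorem finrank_hodgeOneZero_eq_genus (hX : IsSmoothProjective n X) :
    Module.finrank ℂ (hodgeOneZero hX) = Literature.NumberTheory.DiophantineGeometry.genus X := by
  have h := finrank_bettiCohomology_one_eq_two_mul_finrank_hodgeOneZero hX
  unfold Literature.NumberTheory.DiophantineGeometry.genus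
  omega

end HodgeGenus

/-! ### §2 Abelian varieties: `h^{1,0}(A) = h^{0,1}(A) = dim A` -/

section AbelianVarieties

variable {m : ℕ} (A : Motives.AbelianVariety ℂ)

/-- **`h^{1,0}(A) = dim A`** for a complex abelian variety (Mumford §1 (4): `H¹(X, ℂ) = T^∨ ⊕ T̄^∨`
with `T = H⁰(X, Ω¹)^∨` of dimension `g`; here from `b₁(A(ℂ)) = 2 dim A`,
`AbelianVariety.finrank_complexBetti_one`, and `b₁ = 2 h^{1,0}`), for any presentation
`hA : IsSmoothProjective m A.X` of `A` as a smooth projective variety.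
[cite: MumfordAV1970, §1 (4)] [cite: VoisinHodgeI2002, §6.1.3 Cor. 6.14] -/
theorem AbelianVariety.finrank_hodgeOneZero_eq_dim (hA : IsSmoothProjective m A.X) :
    Module.finrank ℂ (hodgeOneZero hA) = A.dim := by
  have h := finrank_complexBetti_one_eq_two_mul_finrank_hodgeOneZero hA
  rw [Motives.AbelianVariety.finrank_complexBetti_one] at h
  omega

/-- **`h^{0,1}(A) = dim A`** for a complex abelian variety. [cite: MumfordAV1970, §1 (4)]
[cite: VoisinHodgeI2002, §6.1.3 Cor. 6.12] -/
theorem AbelianVariety.finrank_hodgeZeroOne_eq_dim (hA : IsSmoothProjective m A.X) :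
    Module.finrank ℂ (hodgeZeroOne hA) = A.dim := by
  rw [← finrank_hodgeOneZero_eq_finrank_hodgeZeroOne hA]
  exact AbelianVariety.finrank_hodgeOneZero_eq_dim A hA

end AbelianVarieties

/-! ### §3 Jacobians: `(f^P)^*` is injective on `H¹` and maps `H^{1,0}(J)` into `H^{1,0}(C)`; `dim J ≤ h^{1,0}(C)` -/

section Jacobians

variable {C : Motives.SchemeOver ℂ}

/-- **`(f^P)^* : H¹(J(ℂ); ℂ) → H¹(C(ℂ); ℂ)` is injective**, unconditionally, for every Jacobian
`𝒥` of a smooth projective complex curve and every `P ∈ C(ℂ)`: `(f^P)_* π₁(C(ℂ))` has finite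
index in `π₁(J(ℂ))` (the tree's `Jacobian.index_range_map_abelJacobi_ne_zero`, from the universal
property), so `(f^P)_*` is onto `H₁(-; ℂ)` and `(f^P)^*` is into (Kronecker duality over a field).
[cite: Lange2023AbelianVarietiesC, §4.1.1 and Lemma 4.4.1 (proof)] -/
theorem injective_complexBetti_map_abelJacobi_one (hC : IsSmoothProjective 1 C) (𝒥 : Jacobian C)
    (P : Motives.AlgPoints C ℂ) :
    Function.Injective (complexBetti.map (𝒥.abelJacobi P) 1) :=
  (singularCohomology_map_injective_iff_of_field ℂ _ 1).mpr
    (singularHomology.map_one_surjective_of_index_ne_zero (Y := 𝒥.J.Points ℂ) ℂ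
      (Motives.AlgPoints.mapContinuous (L := ℂ) (𝒥.abelJacobi P)) P
      (Motives.Jacobian.index_range_map_abelJacobi_ne_zero hC 𝒥 P))

/-- **`(f^P)^*` maps `H^{1,0}(J)` into `H^{1,0}(C)`** (pull-back along a morphism of smooth
projective varieties preserves Hodge types, Voisin I §7.3.2), for any presentation
`hJ : IsSmoothProjective m J` (e.g. `AbelianVariety.isSmoothProjective_holds`).
[cite: VoisinHodgeI2002, §7.3.2] -/
theorem map_hodgeOneZero_abelJacobi_le {m : ℕ} (hC : IsSmoothProjective 1 C) (𝒥 : Jacobian C)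
    (hJ : IsSmoothProjective m 𝒥.J.X) (P : Motives.AlgPoints C ℂ) :
    (hodgeOneZero hJ).map (complexBetti.map (𝒥.abelJacobi P) 1).hom ≤ hodgeOneZero hC := by
  rintro _ ⟨y, hy, rfl⟩
  exact IsOfHodgeType.map_of_isSmoothProjective hy hC hJ (𝒥.abelJacobi P)

/-- `dim_ℂ ((f^P)^* H^{1,0}(J)) = dim J`: `(f^P)^*` is injective and `h^{1,0}(J) = dim J`.
[cite: Lange2023AbelianVarietiesC, §4.1.1 and Lemma 4.4.1 (proof)] [cite: MumfordAV1970, §1 (4)] -/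
theorem finrank_map_hodgeOneZero_abelJacobi {m : ℕ} (hC : IsSmoothProjective 1 C) (𝒥 : Jacobian C)
    (hJ : IsSmoothProjective m 𝒥.J.X) (P : Motives.AlgPoints C ℂ) :
    Module.finrank ℂ ((hodgeOneZero hJ).map (complexBetti.map (𝒥.abelJacobi P) 1).hom) = 𝒥.J.dim := by
  rw [← AbelianVariety.finrank_hodgeOneZero_eq_dim 𝒥.J hJ]
  exact (Submodule.equivMapOfInjective _
    (injective_complexBetti_map_abelJacobi_one hC 𝒥 P) (hodgeOneZero hJ)).finrank_eq.symm

/-- **`dim J ≤ h^{1,0}(C)` for every Jacobian `𝒥` of a smooth projective complex curve**,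
unconditionally: `(f^P)^*` embeds `H^{1,0}(J)`, of dimension `dim J`, into `H^{1,0}(C)`. One half of
Milne, Prop. 2.1 (`dim J = g = dim Γ(C, Ω¹)`), the Hodge-theoretic twin of the tree's
`Jacobian.dim_le_genus` (`dim J ≤ ½ b₁(C(ℂ))`; the two bounds agree by
`finrank_hodgeOneZero_eq_genus`). [cite: Milne1986JacobianVarieties, §2 Prop. 2.1 and Thm. 2.5]
[cite: Lange2023AbelianVarietiesC, §4.1.1] -/
theorem Jacobian.dim_le_finrank_hodgeOneZero (hC : IsSmoothProjective 1 C) (𝒥 : Jacobian C) :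
    𝒥.J.dim ≤ Module.finrank ℂ (hodgeOneZero hC) := by
  haveI := finite_complexBetti_of_isSmoothProjective hC 1
  obtain ⟨P⟩ := Motives.nonempty_algPoints_of_isSmoothProjective hC
  have hJ : IsSmoothProjective 𝒥.J.dim 𝒥.J.X := Motives.AbelianVariety.isSmoothProjective_holds
  rw [← finrank_map_hodgeOneZero_abelJacobi hC 𝒥 hJ P]
  exact Submodule.finrank_mono (map_hodgeOneZero_abelJacobi_le hC 𝒥 hJ P)

/-! ### §4 The per-curve equivalences and the named fact in Hodge-genus form -/

/-- **`b₁(C(ℂ)) ≤ 2 dim J ⟺ h^{1,0}(C) ≤ dim J`** for one Jacobian of a smooth projective complex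
curve (`b₁ = 2 h^{1,0}`). The left-hand side is the open per-curve kernel of the named facts
`Motives.two_mul_dim_eq_finrank_bettiCohomology` / `Motives.isIso_bettiCohomology_map_abelJacobi`
(`Jacobian.two_mul_dim_eq_finrank_bettiCohomology_of_finrank_le_two_mul_dim`,
`Jacobian.isIso_bettiCohomology_map_abelJacobi_of_finrank_le_two_mul_dim`); the right-hand side is
Milne's "`dim J ≥ g`". [cite: Milne1986JacobianVarieties, §2 Prop. 2.1 and Thm. 2.5] -/
theorem finrank_bettiCohomology_le_two_mul_dim_iff_finrank_hodgeOneZero_le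
    (hC : IsSmoothProjective 1 C) (𝒥 : Jacobian C) :
    Module.finrank ℚ (Motives.bettiCohomology C 1) ≤ 2 * 𝒥.J.dim ↔
      Module.finrank ℂ (hodgeOneZero hC) ≤ 𝒥.J.dim := by
  rw [finrank_bettiCohomology_one_eq_two_mul_finrank_hodgeOneZero hC]
  omega

/-- **`2 dim J = b₁(C(ℂ)) ⟺ dim J = h^{1,0}(C)`** for one Jacobian: Milne's Prop. 2.1
(`dim J = g = dim Γ(C, Ω¹)`) is, word for word with `g` the Hodge genus, the statement of the
named fact `two_mul_dim_eq_finrank_bettiCohomology` at `(C, 𝒥)`.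
[cite: Milne1986JacobianVarieties, §2 Prop. 2.1 and Thm. 2.5] -/
theorem two_mul_dim_eq_finrank_bettiCohomology_iff_dim_eq_finrank_hodgeOneZero
    (hC : IsSmoothProjective 1 C) (𝒥 : Jacobian C) :
    2 * 𝒥.J.dim = Module.finrank ℚ (Motives.bettiCohomology C 1) ↔
      𝒥.J.dim = Module.finrank ℂ (hodgeOneZero hC) := by
  rw [finrank_bettiCohomology_one_eq_two_mul_finrank_hodgeOneZero hC]
  omega

/-- `h^{1,0}(C) ≤ dim J ⟺ dim J = h^{1,0}(C)` (the inequality `dim J ≤ h^{1,0}(C)` being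
unconditional, `Jacobian.dim_le_finrank_hodgeOneZero`). [cite: Milne1986JacobianVarieties, §2 Prop. 2.1 and Thm. 2.5] -/
theorem finrank_hodgeOneZero_le_iff_dim_eq (hC : IsSmoothProjective 1 C) (𝒥 : Jacobian C) :
    Module.finrank ℂ (hodgeOneZero hC) ≤ 𝒥.J.dim ↔ 𝒥.J.dim = Module.finrank ℂ (hodgeOneZero hC) := by
  have h := Jacobian.dim_le_finrank_hodgeOneZero hC 𝒥
  omega

/-- **If `h^{1,0}(C) ≤ dim J` then `(f^P)^* H^{1,0}(J) = H^{1,0}(C)`**: an injective linear map from a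
space of dimension `dim J` into one of dimension `≤ dim J` is onto.
[cite: Lange2023AbelianVarietiesC, §4.1.1 and Lemma 4.4.1 (proof)] -/
theorem map_hodgeOneZero_abelJacobi_eq_of_finrank_le {m : ℕ} (hC : IsSmoothProjective 1 C)
    (𝒥 : Jacobian C) (hJ : IsSmoothProjective m 𝒥.J.X) (P : Motives.AlgPoints C ℂ)
    (h : Module.finrank ℂ (hodgeOneZero hC) ≤ 𝒥.J.dim) :
    (hodgeOneZero hJ).map (complexBetti.map (𝒥.abelJacobi P) 1).hom = hodgeOneZero hC := by
  haveI := finite_complexBetti_of_isSmoothProjective hC 1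
  refine Submodule.eq_of_le_of_finrank_le (map_hodgeOneZero_abelJacobi_le hC 𝒥 hJ P) ?_
  rw [finrank_map_hodgeOneZero_abelJacobi hC 𝒥 hJ P]
  exact h

/-- **`H^{1,0}(C) ∩ range (f^P)^* = (f^P)^* H^{1,0}(J)`** (the non-trivial inclusion: if a
`(1,0)`-class `x` is `(f^P)^* y`, split `y = y' + y''` into types `(1,0)` and `(0,1)`; then
`(f^P)^* y'' = x - (f^P)^* y'` is of both types, hence `0`, and `x = (f^P)^* y'`). Stated as: every
`(1,0)`-class in the range of `(f^P)^*` lies in `(f^P)^* H^{1,0}(J)`.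
[cite: VoisinHodgeI2002, §6.1.3 Cor. 6.14 and §7.3.2] -/
theorem mem_map_hodgeOneZero_abelJacobi_of_mem_range {m : ℕ} (hC : IsSmoothProjective 1 C)
    (𝒥 : Jacobian C) (hJ : IsSmoothProjective m 𝒥.J.X) (P : Motives.AlgPoints C ℂ)
    {x : complexBetti C 1} (hx : x ∈ hodgeOneZero hC)
    (hxr : x ∈ LinearMap.range (complexBetti.map (𝒥.abelJacobi P) 1).hom) :
    x ∈ (hodgeOneZero hJ).map (complexBetti.map (𝒥.abelJacobi P) 1).hom := by
  obtain ⟨y, rfl⟩ := hxr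
  set f := (complexBetti.map (𝒥.abelJacobi P) 1).hom with hf
  -- split `y` along `H¹(J) = H^{1,0}(J) ⊕ H^{0,1}(J)`
  have hy : y ∈ hodgeOneZero hJ ⊔ hodgeZeroOne hJ := by
    rw [(isCompl_hodgeOneZero_hodgeZeroOne hJ).sup_eq_top]
    exact Submodule.mem_top
  obtain ⟨y', hy', y'', hy'', rfl⟩ := Submodule.mem_sup.1 hy
  have h' : f y' ∈ hodgeOneZero hC :=
    IsOfHodgeType.map_of_isSmoothProjective hy' hC hJ (𝒥.abelJacobi P)
  have h'' : f y'' ∈ hodgeZeroOne hC :=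
    IsOfHodgeType.map_of_isSmoothProjective hy'' hC hJ (𝒥.abelJacobi P)
  -- `f y''` is of both types, hence zero
  have h10 : f y'' ∈ hodgeOneZero hC := by
    have : f y'' = f (y' + y'') - f y' := by rw [map_add]; abel
    rw [this]
    exact (hodgeOneZero hC).sub_mem hx h'
  have hzero : f y'' = 0 := eq_zero_of_isOfHodgeType_one_zero_of_zero_one hC h10 h''
  refine ⟨y', hy', ?_⟩
  rw [map_add, hzero, add_zero]

/-- **`H^{1,0}(C) ⊆ range (f^P)^* ⟺ h^{1,0}(C) ≤ dim J`** for one Jacobian and one base point: the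
analytic Albanese property "every holomorphic `1`-form class on `C(ℂ)` is the pull-back of a class on
`J(ℂ)`" (Lange §4.1.1: `J = H⁰(ω_C)^*/H₁(C, ℤ)` is BUILT so that `α_c^*` identifies the invariant
`1`-forms of `J` with `H⁰(ω_C)`) is equivalent, for the tree's abstract Jacobian, to Milne's
`dim J ≥ g`. (`⇐`: `map_hodgeOneZero_abelJacobi_eq_of_finrank_le`; `⇒`: a `(1,0)`-class in the
range comes from `H^{1,0}(J)`, of dimension `dim J`.)
[cite: Lange2023AbelianVarietiesC, §4.1.1 and Lemma 4.4.1 (proof)] [cite: Milne1986JacobianVarieties, §2 Prop. 2.1] -/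
theorem hodgeOneZero_le_range_iff_finrank_hodgeOneZero_le (hC : IsSmoothProjective 1 C)
    (𝒥 : Jacobian C) (P : Motives.AlgPoints C ℂ) :
    hodgeOneZero hC ≤ LinearMap.range (complexBetti.map (𝒥.abelJacobi P) 1).hom ↔
      Module.finrank ℂ (hodgeOneZero hC) ≤ 𝒥.J.dim := by
  haveI := finite_complexBetti_of_isSmoothProjective hC 1
  haveI := finite_complexBetti_abelianVariety 𝒥.J 1
  have hJ : IsSmoothProjective 𝒥.J.dim 𝒥.J.X := Motives.AbelianVariety.isSmoothProjective_holds
  constructor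
  · intro h
    have hle : hodgeOneZero hC ≤ (hodgeOneZero hJ).map (complexBetti.map (𝒥.abelJacobi P) 1).hom :=
      fun x hx ↦ mem_map_hodgeOneZero_abelJacobi_of_mem_range hC 𝒥 hJ P hx (h hx)
    calc Module.finrank ℂ (hodgeOneZero hC)
        ≤ Module.finrank ℂ ((hodgeOneZero hJ).map (complexBetti.map (𝒥.abelJacobi P) 1).hom) :=
          Submodule.finrank_mono hle
      _ = 𝒥.J.dim := finrank_map_hodgeOneZero_abelJacobi hC 𝒥 hJ P
  · intro h
    rw [← map_hodgeOneZero_abelJacobi_eq_of_finrank_le hC 𝒥 hJ P h]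
    exact LinearMap.map_le_range

/-- **If `H^{1,0}(C) ⊆ range (f^P)^*` then `(f^P)^* : H¹(J(ℂ); ℂ) → H¹(C(ℂ); ℂ)` is onto**
(conjugation-free form: `h^{1,0}(C) ≤ dim J`, so `b₁(C) = 2 h^{1,0}(C) ≤ 2 dim J = b₁(J)`, and
`(f^P)^*` is injective). [cite: Lange2023AbelianVarietiesC, §4.1.1 and Lemma 4.4.1 (proof)] -/
theorem surjective_complexBetti_map_abelJacobi_one_of_hodgeOneZero_le_range
    (hC : IsSmoothProjective 1 C) (𝒥 : Jacobian C) (P : Motives.AlgPoints C ℂ)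
    (h : hodgeOneZero hC ≤ LinearMap.range (complexBetti.map (𝒥.abelJacobi P) 1).hom) :
    Function.Surjective (complexBetti.map (𝒥.abelJacobi P) 1) := by
  haveI := finite_complexBetti_of_isSmoothProjective hC 1
  haveI := finite_complexBetti_abelianVariety 𝒥.J 1
  have hdim := (hodgeOneZero_le_range_iff_finrank_hodgeOneZero_le hC 𝒥 P).1 h
  have hle : Module.finrank ℂ (complexBetti C 1) ≤ Module.finrank ℂ (complexBetti 𝒥.J.X 1) := by
    rw [finrank_complexBetti_one_eq_two_mul_finrank_hodgeOneZero hC,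
      Motives.AbelianVariety.finrank_complexBetti_one]
    omega
  have hinj := injective_complexBetti_map_abelJacobi_one hC 𝒥 P
  have heq : Module.finrank ℂ (complexBetti 𝒥.J.X 1) = Module.finrank ℂ (complexBetti C 1) :=
    le_antisymm (LinearMap.finrank_le_finrank_of_injective hinj) hle
  exact (LinearMap.injective_iff_surjective_of_finrank_eq_finrank heq).mp hinj

/-- **The named fact in Hodge-genus form (Milne, Prop. 2.1 verbatim).**
`two_mul_dim_eq_finrank_bettiCohomology` (`2 dim J = b₁(C(ℂ))` for all Jacobians of smooth
projective complex curves) is equivalent to `dim J = h^{1,0}(C)` for all of them — "The Jacobian has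
dimension `g = dim Γ(C, Ω¹)`", with `Γ(C^an, Ω¹) = H^{1,0}(C)`.
[cite: Milne1986JacobianVarieties, §2 Prop. 2.1 and Thm. 2.5] -/
theorem two_mul_dim_eq_finrank_bettiCohomology_iff_forall_dim_eq_finrank_hodgeOneZero :
    Motives.two_mul_dim_eq_finrank_bettiCohomology ↔
      ∀ (C : Motives.SchemeOver ℂ) (hC : IsSmoothProjective 1 C) (𝒥 : Jacobian C),
        𝒥.J.dim = Module.finrank ℂ (hodgeOneZero hC) :=
  ⟨fun h C hC 𝒥 ↦ (two_mul_dim_eq_finrank_bettiCohomology_iff_dim_eq_finrank_hodgeOneZero hC 𝒥).1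
      (h C hC 𝒥),
    fun h C hC 𝒥 ↦ (two_mul_dim_eq_finrank_bettiCohomology_iff_dim_eq_finrank_hodgeOneZero hC 𝒥).2
      (h C hC 𝒥)⟩

/-- **The named fact from the Hodge-genus bound `h^{1,0}(C) ≤ dim J`** ("`dim J ≥ g`") for all
Jacobians of smooth projective complex curves — the other inequality being the theorem
`Jacobian.dim_le_finrank_hodgeOneZero`. [cite: Milne1986JacobianVarieties, §2 Prop. 2.1 and Thm. 2.5] -/
theorem two_mul_dim_eq_finrank_bettiCohomology_of_forall_finrank_hodgeOneZero_le
    (h : ∀ (C : Motives.SchemeOver ℂ) (hC : IsSmoothProjective 1 C) (𝒥 : Jacobian C),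
      Module.finrank ℂ (hodgeOneZero hC) ≤ 𝒥.J.dim) :
    Motives.two_mul_dim_eq_finrank_bettiCohomology :=
  Motives.two_mul_dim_eq_finrank_bettiCohomology_of_finrank_le fun C hC 𝒥 ↦
    (finrank_bettiCohomology_le_two_mul_dim_iff_finrank_hodgeOneZero_le hC 𝒥).2 (h C hC 𝒥)

/-- **The named fact is equivalent to the Hodge-genus bound** `∀ C 𝒥, h^{1,0}(C) ≤ dim J`.
[cite: Milne1986JacobianVarieties, §2 Prop. 2.1 and Thm. 2.5] -/
theorem two_mul_dim_eq_finrank_bettiCohomology_iff_forall_finrank_hodgeOneZero_le :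
    Motives.two_mul_dim_eq_finrank_bettiCohomology ↔
      ∀ (C : Motives.SchemeOver ℂ) (hC : IsSmoothProjective 1 C) (𝒥 : Jacobian C),
        Module.finrank ℂ (hodgeOneZero hC) ≤ 𝒥.J.dim :=
  ⟨fun h C hC 𝒥 ↦ (finrank_bettiCohomology_le_two_mul_dim_iff_finrank_hodgeOneZero_le hC 𝒥).1
      (h C hC 𝒥).ge,
    two_mul_dim_eq_finrank_bettiCohomology_of_forall_finrank_hodgeOneZero_le⟩

/-- **The named fact is equivalent to the analytic Albanese property** "for every smooth projective
complex curve `C`, every Jacobian `𝒥` and every `P ∈ C(ℂ)`, each holomorphic `1`-form class on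
`C(ℂ)` is pulled back from `J(ℂ)` along `f^P`" — the content of Lange's description
`J(C) = H⁰(ω_C)^*/H₁(C, ℤ)` (§4.1.1) that the tree's universal-property Jacobian does not yet have.
This is the precise open kernel of `two_mul_dim_eq_finrank_bettiCohomology` (and of
`isIso_bettiCohomology_map_abelJacobi`, `Motives.two_mul_dim_eq_finrank_bettiCohomology_iff_isIso`).
[cite: Lange2023AbelianVarietiesC, §4.1.1 and Lemma 4.4.1 (proof)] [cite: Milne1986JacobianVarieties, §2 Prop. 2.1 and Thm. 2.5] -/
theorem two_mul_dim_eq_finrank_bettiCohomology_iff_forall_hodgeOneZero_le_range :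
    Motives.two_mul_dim_eq_finrank_bettiCohomology ↔
      ∀ (C : Motives.SchemeOver ℂ) (hC : IsSmoothProjective 1 C) (𝒥 : Jacobian C)
        (P : Motives.AlgPoints C ℂ),
        hodgeOneZero hC ≤ LinearMap.range (complexBetti.map (𝒥.abelJacobi P) 1).hom := by
  rw [two_mul_dim_eq_finrank_bettiCohomology_iff_forall_finrank_hodgeOneZero_le]
  refine ⟨fun h C hC 𝒥 P ↦ (hodgeOneZero_le_range_iff_finrank_hodgeOneZero_le hC 𝒥 P).2 (h C hC 𝒥),
    fun h C hC 𝒥 ↦ ?_⟩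
  obtain ⟨P⟩ := Motives.nonempty_algPoints_of_isSmoothProjective hC
  exact (hodgeOneZero_le_range_iff_finrank_hodgeOneZero_le hC 𝒥 P).1 (h C hC 𝒥 P)

/-- `isIso_bettiCohomology_map_abelJacobi` from the Hodge-genus bound, through
`Motives.isIso_bettiCohomology_map_abelJacobi_of_two_mul_dim_eq`.
[cite: Lange2023AbelianVarietiesC, §4.1.1 and Lemma 4.4.1 (proof)] -/
theorem isIso_bettiCohomology_map_abelJacobi_of_forall_finrank_hodgeOneZero_le
    (h : ∀ (C : Motives.SchemeOver ℂ) (hC : IsSmoothProjective 1 C) (𝒥 : Jacobian C),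
      Module.finrank ℂ (hodgeOneZero hC) ≤ 𝒥.J.dim) :
    Motives.isIso_bettiCohomology_map_abelJacobi :=
  Motives.isIso_bettiCohomology_map_abelJacobi_of_two_mul_dim_eq
    (two_mul_dim_eq_finrank_bettiCohomology_of_forall_finrank_hodgeOneZero_le h)

/-! ### §4b The Albanese criterion in Hodge-genus form: any `φ : C → A` capturing `H^{1,0}(C)` suffices -/

/-- **Every morphism `φ : C → A` to a complex abelian variety factors on `Hⁱ(-(ℂ); ℂ)` through
`f^P`**: `φ^* = (f^P)^* ∘ ψ^*` for the homomorphism `ψ = descPointed P (φ · φ(P)⁻¹)` of Milne,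
Prop. 6.1 (the translate `φ · φ(P)⁻¹` acts as `φ`, `complexBetti_map_mul_const`); the tree's
`Jacobian.bettiCohomology_map_eq_comp_abelJacobi` is the same over `ℚ`.
[cite: Milne1986JacobianVarieties, §6 Prop. 6.1] -/
theorem complexBetti_map_eq_comp_abelJacobi (𝒥 : Jacobian C) (P : Motives.AlgPoints C ℂ)
    {A : Motives.AbelianVariety ℂ} (φ : C ⟶ A.X) (i : ℕ) :
    complexBetti.map φ i =
      complexBetti.map
          (𝒥.descPointed P _ (Motives.Jacobian.point_comp_mul_const_inv P φ)).hom.hom.hom i ≫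
        complexBetti.map (𝒥.abelJacobi P) i := by
  rw [← complexBetti.map_comp,
    𝒥.abelJacobi_descPointed P _ (Motives.Jacobian.point_comp_mul_const_inv P φ),
    complexBetti_map_mul_const]

/-- **`range φ^* ⊆ range (f^P)^*` on `Hⁱ(C(ℂ); ℂ)`** for every morphism `φ : C → A` to a complex
abelian variety, every Jacobian `𝒥` of `C` and every `P ∈ C(ℂ)` (universal property, Milne
Prop. 6.1). [cite: Milne1986JacobianVarieties, §6 Prop. 6.1] -/
theorem range_complexBetti_map_le_range_abelJacobi (𝒥 : Jacobian C) (P : Motives.AlgPoints C ℂ)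
    {A : Motives.AbelianVariety ℂ} (φ : C ⟶ A.X) (i : ℕ) :
    LinearMap.range (complexBetti.map φ i).hom ≤
      LinearMap.range (complexBetti.map (𝒥.abelJacobi P) i).hom := by
  rw [complexBetti_map_eq_comp_abelJacobi 𝒥 P φ i, ModuleCat.hom_comp]
  exact LinearMap.range_comp_le_range _ _

/-- **The Albanese criterion in Hodge-genus form.** If SOME morphism `φ : C → A` to SOME complex
abelian variety captures every holomorphic `1`-form class of `C(ℂ)` (`H^{1,0}(C) ⊆ range φ^*`), then
`h^{1,0}(C) ≤ dim J` for every Jacobian `𝒥` of `C` — hence `dim J = h^{1,0}(C)` and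
`2 dim J = b₁(C(ℂ))` at `(C, 𝒥)`. In the printed proofs `A` is the analytic Jacobian
`Γ(C(ℂ), Ω¹)^∨/H₁(C(ℂ), ℤ)`, an abelian variety by its Riemann form, and `φ` its Abel–Jacobi map,
for which the hypothesis holds by construction (Milne §2 p. 174, Thm. 2.5; Lange §4.1.1–4.1.3).
[cite: Milne1986JacobianVarieties, §2 Thm. 2.5 and §6 Prop. 6.1] [cite: Lange2023AbelianVarietiesC, §4.1.1 and Lemma 4.4.1 (proof)] -/
theorem finrank_hodgeOneZero_le_dim_of_hodgeOneZero_le_range (hC : IsSmoothProjective 1 C)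
    (𝒥 : Jacobian C) {A : Motives.AbelianVariety ℂ} (φ : C ⟶ A.X)
    (h : hodgeOneZero hC ≤ LinearMap.range (complexBetti.map φ 1).hom) :
    Module.finrank ℂ (hodgeOneZero hC) ≤ 𝒥.J.dim := by
  obtain ⟨P⟩ := Motives.nonempty_algPoints_of_isSmoothProjective hC
  exact (hodgeOneZero_le_range_iff_finrank_hodgeOneZero_le hC 𝒥 P).1
    (h.trans (range_complexBetti_map_le_range_abelJacobi 𝒥 P φ 1))

/-- `2 dim J = b₁(C(ℂ))` at `(C, 𝒥)` as soon as some `φ : C → A` captures `H^{1,0}(C)`.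
[cite: Milne1986JacobianVarieties, §2 Prop. 2.1 and Thm. 2.5] -/
theorem two_mul_dim_eq_finrank_bettiCohomology_at_of_hodgeOneZero_le_range
    (hC : IsSmoothProjective 1 C) (𝒥 : Jacobian C) {A : Motives.AbelianVariety ℂ} (φ : C ⟶ A.X)
    (h : hodgeOneZero hC ≤ LinearMap.range (complexBetti.map φ 1).hom) :
    2 * 𝒥.J.dim = Module.finrank ℚ (Motives.bettiCohomology C 1) :=
  (two_mul_dim_eq_finrank_bettiCohomology_iff_dim_eq_finrank_hodgeOneZero hC 𝒥).2
    ((finrank_hodgeOneZero_le_iff_dim_eq hC 𝒥).1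
      (finrank_hodgeOneZero_le_dim_of_hodgeOneZero_le_range hC 𝒥 φ h))

/-- **The named fact is equivalent to the existence, for every smooth projective complex curve with
a Jacobian, of SOME morphism to SOME complex abelian variety capturing all its holomorphic `1`-form
classes** — the existence statement of the analytic theory (the Albanese torus
`Γ(C(ℂ), Ω¹)^∨/H₁(C(ℂ), ℤ)` is an abelian variety and its Abel–Jacobi map is algebraic), freed of any
reference to the universal-property Jacobian `𝒥` (which enters only through `𝒥.J.dim` on the left
and as an existence witness on the right: `A = J`, `φ = f^P`).
[cite: Milne1986JacobianVarieties, §2 Prop. 2.1, Thm. 2.5 and §6 Prop. 6.1] [cite: Lange2023AbelianVarietiesC, §4.1.1 and Lemma 4.4.1 (proof)] -/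
theorem two_mul_dim_eq_finrank_bettiCohomology_iff_forall_exists_hodgeOneZero_le_range :
    Motives.two_mul_dim_eq_finrank_bettiCohomology ↔
      ∀ (C : Motives.SchemeOver ℂ) (hC : IsSmoothProjective 1 C) (_ : Jacobian C),
        ∃ (A : Motives.AbelianVariety ℂ) (φ : C ⟶ A.X),
          hodgeOneZero hC ≤ LinearMap.range (complexBetti.map φ 1).hom := by
  constructor
  · intro h C hC 𝒥
    obtain ⟨P⟩ := Motives.nonempty_algPoints_of_isSmoothProjective hC
    exact ⟨𝒥.J, 𝒥.abelJacobi P,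
      (two_mul_dim_eq_finrank_bettiCohomology_iff_forall_hodgeOneZero_le_range.1 h) C hC 𝒥 P⟩
  · intro h C hC 𝒥
    obtain ⟨A, φ, hφ⟩ := h C hC 𝒥
    exact two_mul_dim_eq_finrank_bettiCohomology_at_of_hodgeOneZero_le_range hC 𝒥 φ hφ

end Jacobians

/-! ### §5 Schoen's two cyclic-Prym facts from the Hodge-genus bound on their own data -/

section Assembly

/-- **Schoen's degree-`6` fact from the Hodge-genus bound `h^{1,0}(C) ≤ dim J = 25` on its own data
and one non-zero algebraic Weil class.** Hypothesis (i-H): for the genus-`25` curve `C` of the fact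
(smooth projective, `𝒥.J.dim = 25`, `α` of order `6` with `α²`, `α³` fixed-point free),
`h^{1,0}(C) ≤ dim J` — Milne's `dim J ≥ g` for THIS curve, equivalently `b₁(C(ℂ)) ≤ 50`
(`finrank_bettiCohomology_le_two_mul_dim_iff_finrank_hodgeOneZero_le`), supplied by the named fact
`two_mul_dim_eq_finrank_bettiCohomology`; hypothesis (iii′): one non-zero algebraic class in the
Weil plane `E₊ ⊔ E₋` of `(B, ψ₀)` (Schoen's cycle, Cor. 3.1 with Thm. 2.0). Through
`Schoen1988_cyclicPrym_weilClasses_algebraic_degreeSix_of_finrank_le_of_exists_weilClass`.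
[cite: Schoen1988HodgeWeil, Cor. 3.1 (p. 24) with Thm. 2.0 (p. 11)] [cite: Milne1986JacobianVarieties, §2 Prop. 2.1] -/
theorem Schoen1988_cyclicPrym_weilClasses_algebraic_degreeSix_of_finrank_hodgeOneZero_le_of_exists_weilClass
    (hg : ∀ (C : Motives.SchemeOver ℂ) (𝒥 : Jacobian C) (α : C ⟶ C)
      (hC : Motives.IsSmoothProjective 1 C), 𝒥.J.dim = 25 →
      α ≫ α ≫ α ≫ α ≫ α ≫ α = 𝟙 C →
      (∀ P : Motives.ComplexPoints C, P ≫ (α ≫ α) ≠ P ∧ P ≫ (α ≫ α ≫ α) ≠ P) →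
      Module.finrank ℂ (hodgeOneZero hC) ≤ 𝒥.J.dim)
    (hZ : ∀ (C : Motives.SchemeOver ℂ) (𝒥 : Jacobian C) (α : C ⟶ C),
      Motives.IsSmoothProjective 1 C → 𝒥.J.dim = 25 →
      α ≫ α ≫ α ≫ α ≫ α ≫ α = 𝟙 C →
      (∀ P : Motives.ComplexPoints C, P ≫ (α ≫ α) ≠ P ∧ P ≫ (α ≫ α ≫ α) ≠ P) →
    ∀ (s : 𝒥.J ⟶ 𝒥.J), s = 𝒥.pushforward 𝒥 α →
    ∀ (sB ψ₀ : Motives.AbelianVariety.kerComponent (𝟙 𝒥.J - s + s ≫ s) ⟶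
        Motives.AbelianVariety.kerComponent (𝟙 𝒥.J - s + s ≫ s)),
      sB ≫ Motives.AbelianVariety.kerComponentι (𝟙 𝒥.J - s + s ≫ s) =
        Motives.AbelianVariety.kerComponentι (𝟙 𝒥.J - s + s ≫ s) ≫ s →
      ψ₀ = 𝟙 _ + 2 • (sB ≫ sB) →
      ∃ c ∈ Module.End.eigenspace
            (complexBetti.map ((2 : ℤ) • 𝟙 (Motives.AbelianVariety.kerComponent (𝟙 𝒥.J - s + s ≫ s)) +
              ψ₀).hom.hom.hom 8).hom ((2 + Complex.I * (Real.sqrt (3 : ℝ) : ℂ)) ^ 8) ⊔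
          Module.End.eigenspace
            (complexBetti.map ((2 : ℤ) • 𝟙 (Motives.AbelianVariety.kerComponent (𝟙 𝒥.J - s + s ≫ s)) +
              ψ₀).hom.hom.hom 8).hom ((2 - Complex.I * (Real.sqrt (3 : ℝ) : ℂ)) ^ 8),
        c ∈ algebraicClasses (Motives.AbelianVariety.kerComponent (𝟙 𝒥.J - s + s ≫ s)).X 4 ∧ c ≠ 0) :
    Schoen1988_cyclicPrym_weilClasses_algebraic_degreeSix :=
  Schoen1988_cyclicPrym_weilClasses_algebraic_degreeSix_of_finrank_le_of_exists_weilClass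
    (fun C 𝒥 α hC h25 hα hfree ↦
      (finrank_bettiCohomology_le_two_mul_dim_iff_finrank_hodgeOneZero_le hC 𝒥).2
        (hg C 𝒥 α hC h25 hα hfree))
    hZ

/-- **Schoen's degree-`3` fact from the Hodge-genus bound `h^{1,0}(C) ≤ dim J = 13` on its own data
and one non-zero algebraic Weil class**, through
`Schoen1988_cyclicPrym_weilClasses_algebraic_degreeThree_of_finrank_le_of_exists_weilClass`.
[cite: Schoen1988HodgeWeil, Cor. 3.1 (p. 24) with Thm. 2.0 (p. 11)] [cite: Milne1986JacobianVarieties, §2 Prop. 2.1] -/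
theorem Schoen1988_cyclicPrym_weilClasses_algebraic_degreeThree_of_finrank_hodgeOneZero_le_of_exists_weilClass
    (hg : ∀ (C : Motives.SchemeOver ℂ) (𝒥 : Jacobian C) (α : C ⟶ C)
      (hC : Motives.IsSmoothProjective 1 C), 𝒥.J.dim = 13 →
      α ≫ α ≫ α = 𝟙 C →
      (∀ P : Motives.ComplexPoints C, P ≫ α ≠ P) →
      Module.finrank ℂ (hodgeOneZero hC) ≤ 𝒥.J.dim)
    (hZ : ∀ (C : Motives.SchemeOver ℂ) (𝒥 : Jacobian C) (α : C ⟶ C),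
      Motives.IsSmoothProjective 1 C → 𝒥.J.dim = 13 →
      α ≫ α ≫ α = 𝟙 C →
      (∀ P : Motives.ComplexPoints C, P ≫ α ≠ P) →
    ∀ (s : 𝒥.J ⟶ 𝒥.J), s = 𝒥.pushforward 𝒥 α →
    ∀ (sP ψ₀ : Motives.AbelianVariety.kerComponent (𝟙 𝒥.J + s + s ≫ s) ⟶
        Motives.AbelianVariety.kerComponent (𝟙 𝒥.J + s + s ≫ s)),
      sP ≫ Motives.AbelianVariety.kerComponentι (𝟙 𝒥.J + s + s ≫ s) =
        Motives.AbelianVariety.kerComponentι (𝟙 𝒥.J + s + s ≫ s) ≫ s →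
      ψ₀ = 𝟙 _ + 2 • sP →
      ∃ c ∈ weilClassesOf (Motives.AbelianVariety.kerComponent (𝟙 𝒥.J + s + s ≫ s)) ψ₀ 4 3,
        c ∈ algebraicClasses (Motives.AbelianVariety.kerComponent (𝟙 𝒥.J + s + s ≫ s)).X 4 ∧ c ≠ 0) :
    Schoen1988_cyclicPrym_weilClasses_algebraic_degreeThree :=
  Schoen1988_cyclicPrym_weilClasses_algebraic_degreeThree_of_finrank_le_of_exists_weilClass
    (fun C 𝒥 α hC h13 hα hfree ↦
      (finrank_bettiCohomology_le_two_mul_dim_iff_finrank_hodgeOneZero_le hC 𝒥).2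
        (hg C 𝒥 α hC h13 hα hfree))
    hZ

end Assembly

end Literature.AlgebraicGeometry.HodgeTheory

end
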